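import Summits.HodgeConjecture.HodgeConjecture.Theorems.A3Liu413LevelSummand
import Summits.HodgeConjecture.HodgeConjecture.Theorems.A3Liu413ClassWeights
import Summits.HodgeConjecture.HodgeConjecture.Theorems.A3Liu418TowerLevelRepresentatives
import Mathlib.GroupTheory.Commensurable
import Mathlib.GroupTheory.DoubleCoset
import HarnessLib

/-!
# The CLASS SETS `U(V)(L₀)\U(V)(𝔸_{L₀,f})/K` of the levels, in the currency of the tower's level carriers `towerLevel Γ`

Fan A, binder `h413` ([Liu 2021, Prop. 4.13]), junction «Matsushima at the pin», row III-4′(b), MODEL-SIDE instantiation for A-p10's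
class-sum (b6) (`SPEC-b6-LevelFormAssembly.md`): the level form is `B_Γ(c, c') := Σ_{q ∈ U\G/K} w_Γ(q) · B_{Γ_{q.out}}(c q.out, c' q.out)`
with `G := U(V)(𝔸_{L₀,f}) = ↥V.adelicFin`, `U := U(V)(L₀)` embedded as `(ρ V).range`, `K := Γ.K`, and weights from the generic class-set
mass calculus (`Literature.GroupTheory.ClassSetMass`, `OrbitIndexSum`).  This file supplies exactly the MODEL-SIDE hypotheses those generic
theorems consume, and the dictionary between the family relation `Rel Γ γ h h'` of `Model/TowerLevel` and Mathlib's double cosets: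

* §1 (the family of open compact subgroups of `U(V)(𝔸_{L₀,f})` — `openCompact_map_conj`, `openCompact_commensurable`, `level_mem_openCompact` —
  is A-p10's `A3Liu413ClassWeights`, imported) the compact opens of two levels are commensurable, of finite relative index
  (`commensurable_K`, `isFiniteRelIndex_K`, `isFiniteRelIndex_map_conj_K`);
* §2 `Rel Γ γ h h'` for some `γ` **iff** `h, h'` have the same `(U, K)`-double coset (`mk_eq_of_rel`, `exists_rel_of_mk_eq`,
  `exists_rel_iff_mk_eq`, `exists_rel_out_of_mk_eq`; `exists_rel_out` is A-p18's `A3Liu418TowerLevelRepresentatives`); the conjugate level's compact open is the conjugate subgroup, by `rfl` (`K_conj_eq_map`);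
* §3 the class sets are finite (`finite_classSet`, alias of `HermSpace3.finite_doubleCoset_range_ρ`, Godement compactness);
* §4 a family `c ∈ towerLevel Γ` is determined by its values on representatives: `c q.out = 0` for every class `q` forces `c = 0`
  (`eq_zero_of_forall_apply_out_eq_zero`, `exists_apply_out_ne_zero`);
* §5 the Hodge–Riemann summand `y ↦ B_{Γ_y}(c y, c' y)` of (S) is a CLASS FUNCTION (`hrForm_apply_eq_of_mk_eq`, `hrForm_summand_mul`),
  with real non-negative diagonal (`hrForm_apply_self_im`, `hrForm_apply_self_re_nonneg`).

No definitions; HC_CM is proved only modulo the 7 printed citations until rung 0 closes (§5 consumes the named fact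
`BallQuotientKaehlerClassSystem` as the hypothesis `hΩ`, like (S)).
-/

noncomputable section

open scoped Matrix TensorProduct ComplexConjugate
open Matrix Function Set
open NumberField CategoryTheory
open Literature.AlgebraicGeometry.Motives
open Literature.AlgebraicGeometry.ShimuraVarieties
open Literature.AlgebraicGeometry.HodgeTheory
open Literature.NumberTheory.Automorphic
open Literature.NumberTheory.Automorphic.PicardCM
open Literature.NumberTheory.Transcendental (Arapura2012_Cor_15_4_6)

namespace HodgeCM

namespace Model.TowerLevel

open HodgeCM.Model.LevelTranslate

variable {L : CMField} {ι₁ : L →+* ℂ} {V : HermSpace3 L ι₁}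

/-! ## §1 The compact opens of the levels: commensurable, of finite relative index -/

/-- The compact opens of any two levels are commensurable. [folklore] -/
theorem commensurable_K (Δ Δ' : Level V) : Subgroup.Commensurable Δ.K Δ'.K :=
  openCompact_commensurable V _ (level_mem_openCompact V Δ) _ (level_mem_openCompact V Δ')

/-- `[K(Δ) : K(Δ') ∩ K(Δ)] < ∞` as the instance-shaped fact `Δ'.K.IsFiniteRelIndex Δ.K` (for `Δ' ≤ Δ` this is the finiteness of the
index `[K : K']` consumed by `Literature.GroupTheory.sum_fibre_relIndex_inf_map_conj`). [folklore] -/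
theorem isFiniteRelIndex_K (Δ Δ' : Level V) : Δ'.K.IsFiniteRelIndex Δ.K :=
  ⟨relIndex_ne_zero_of_isCompact_isOpen Δ.isCompact_K Δ'.isOpen_K⟩

/-- A conjugate of a level's `K` has finite relative index in any level's `K` (translates). [folklore] -/
theorem isFiniteRelIndex_map_conj_K (Δ Δ' : Level V) (g : V.adelicFin) :
    (Δ'.K.map (MulAut.conj g).toMonoidHom).IsFiniteRelIndex Δ.K :=
  ⟨relIndex_ne_zero_of_isCompact_isOpen Δ.isCompact_K (Level.isOpen_conjK Δ'.isOpen_K g)⟩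

/-! ## §2 The family relation `Rel Γ γ h h'` and the double cosets `U(V)(L₀) h K` -/

/-- **The conjugate level's compact open is the conjugate subgroup**, definitionally: `(Γ.conj g).K = g K g⁻¹ = K.map (conj g)` — so the
generic class-set lemmas over `K.map (MulAut.conj g).toMonoidHom` (`ClassSetMass.sum_quotient_map_conj_eq`, `classWeight_map_conj`) apply to
translated levels verbatim. [folklore] -/
theorem K_conj_eq_map (Γ : Level V) (g : V.adelicFin) (hΓ : Γ.BelowConjThree) :
    (Γ.conj g hΓ).K = Γ.K.map (MulAut.conj g).toMonoidHom := rfl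

/-- `Rel Γ γ h h'` (`h' = (γ)_f h k`, `k ∈ K`) puts `h, h'` in the same `(U(V)(L₀), K)`-double coset. [folklore] -/
theorem mk_eq_of_rel {Γ : Level V} {γ : ↥(Urat V)} {h h' : V.adelicFin} (r : Rel Γ γ h h') :
    DoubleCoset.mk (ρ V).range Γ.K h = DoubleCoset.mk (ρ V).range Γ.K h' := by
  obtain ⟨k, hk, rfl⟩ := r
  exact (DoubleCoset.eq _ _ _ _).mpr ⟨ρ V γ, ⟨γ, rfl⟩, k, hk, rfl⟩

/-- Conversely, indices in one `(U(V)(L₀), K)`-double coset are related by some rational `γ`. [folklore] -/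
theorem exists_rel_of_mk_eq {Γ : Level V} {h h' : V.adelicFin}
    (e : DoubleCoset.mk (ρ V).range Γ.K h = DoubleCoset.mk (ρ V).range Γ.K h') : ∃ γ : ↥(Urat V), Rel Γ γ h h' := by
  obtain ⟨u, ⟨γ, rfl⟩, k, hk, he⟩ := (DoubleCoset.eq _ _ _ _).mp e
  exact ⟨γ, k, hk, he⟩

/-- **Dictionary**: `(∃ γ, Rel Γ γ h h') ↔ U(V)(L₀) h K = U(V)(L₀) h' K`. [folklore] -/
theorem exists_rel_iff_mk_eq (Γ : Level V) (h h' : V.adelicFin) :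
    (∃ γ : ↥(Urat V), Rel Γ γ h h') ↔ DoubleCoset.mk (ρ V).range Γ.K h = DoubleCoset.mk (ρ V).range Γ.K h' :=
  ⟨fun ⟨_, r⟩ => mk_eq_of_rel r, exists_rel_of_mk_eq⟩

/-- For a class `q`, every index `h` of `q` is related to the representative `q.out` (cf. `exists_rel_out` of
`A3Liu418TowerLevelRepresentatives`, the case `q = [h]`). [folklore] -/
theorem exists_rel_out_of_mk_eq (Γ : Level V) {h : V.adelicFin}
    {q : DoubleCoset.Quotient (((ρ V).range : Subgroup V.adelicFin) : Set V.adelicFin) (Γ.K : Set V.adelicFin)}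
    (e : DoubleCoset.mk (ρ V).range Γ.K h = q) : ∃ γ : ↥(Urat V), Rel Γ γ h q.out :=
  exists_rel_of_mk_eq (by rw [e, DoubleCoset.out_eq'])

/-! ## §3 Finiteness of the class sets -/

/-- **`U(V)(L₀)\U(V)(𝔸_{L₀,f})/K` is finite** for every level (`[L:ℚ] ≠ 2`, i.e. `V` anisotropic: Godement compactness —
`HermSpace3.finite_doubleCoset_range_ρ`); consumers obtain the `Fintype` by `Fintype.ofFinite`. [folklore] -/
theorem finite_classSet (hL : Module.finrank ℚ L ≠ 2) (Γ : Level V) :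
    Finite (DoubleCoset.Quotient (((ρ V).range : Subgroup V.adelicFin) : Set V.adelicFin) (Γ.K : Set V.adelicFin)) :=
  HermSpace3.finite_doubleCoset_range_ρ V hL Γ.K Γ.isOpen_K

/-- The same under the face prefix's `6 ≤ [L:ℚ]`. [folklore] -/
theorem finite_classSet_of_six_le (h6 : 6 ≤ Module.finrank ℚ L) (Γ : Level V) :
    Finite (DoubleCoset.Quotient (((ρ V).range : Subgroup V.adelicFin) : Set V.adelicFin) (Γ.K : Set V.adelicFin)) :=
  finite_classSet (by omega) Γ

/-- The class set of a conjugate subgroup `g K g⁻¹` of a level is finite too (translated levels). [folklore] -/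
theorem finite_classSet_map_conj (hL : Module.finrank ℚ L ≠ 2) (Γ : Level V) (g : V.adelicFin) :
    Finite (DoubleCoset.Quotient (((ρ V).range : Subgroup V.adelicFin) : Set V.adelicFin)
      (Γ.K.map (MulAut.conj g).toMonoidHom : Set V.adelicFin)) :=
  HermSpace3.finite_doubleCoset_range_ρ V hL _ (Level.isOpen_conjK Γ.isOpen_K g)

/-! ## §4 Families are determined by their values on class representatives -/

section Families

variable (hHD : exists_isReal_hodgeModel) (hI : hodgePQ_independent_of_hodgeModel)
  (hU : BallQuotientUniformisedDatum) (h₃ : CMAbelianVarietyRealised) (hA : Arapura2012_Cor_15_4_6)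
variable {Γ : Level V} {hΓ : Γ.BelowConjThree}

/-- **A family vanishing on every class representative vanishes**: `c h = t_γ^* (c [h].out)` (`apply_eq_trPull` along `exists_rel_out`; equivalently `eval_injective` of `A3Liu418TowerLevelRepresentatives`).
[folklore] -/
theorem eq_zero_of_forall_apply_out_eq_zero (c : towerLevel hHD hI hU h₃ hA Γ hΓ)
    (h0 : ∀ q : DoubleCoset.Quotient (((ρ V).range : Subgroup V.adelicFin) : Set V.adelicFin) (Γ.K : Set V.adelicFin),
      (c : Π h, W hHD hI hU h₃ Γ hΓ h) q.out = 0) :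
    c = 0 := by
  refine Subtype.ext (funext fun h => ?_)
  obtain ⟨γ, r⟩ := exists_rel_out (Γ := Γ) h
  rw [apply_eq_trPull hHD hI hU h₃ hA c r (transCond_of_rel hΓ r), h0, map_zero]
  rfl

/-- Hence a non-zero family is non-zero at some class representative (positivity of the class-sum, `hpos`). [folklore] -/
theorem exists_apply_out_ne_zero (c : towerLevel hHD hI hU h₃ hA Γ hΓ) (hc : c ≠ 0) :
    ∃ q : DoubleCoset.Quotient (((ρ V).range : Subgroup V.adelicFin) : Set V.adelicFin) (Γ.K : Set V.adelicFin),
      (c : Π h, W hHD hI hU h₃ Γ hΓ h) q.out ≠ 0 := by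
  by_contra! h0
  exact hc (eq_zero_of_forall_apply_out_eq_zero hHD hI hU h₃ hA c h0)

end Families

/-! ## §5 The Hodge–Riemann summand is a class function -/

section Summand

variable (hHD : exists_isReal_hodgeModel) (hI : hodgePQ_independent_of_hodgeModel)
  (hU : BallQuotientUniformisedDatum) (h₃ : CMAbelianVarietyRealised) (hA : Arapura2012_Cor_15_4_6)
variable (hΩ : BallQuotientKaehlerClassSystem)
variable (B : ∀ Δ : Level V, Coh hHD hI hU h₃ Δ 1 →ₗ⋆[ℂ] Coh hHD hI hU h₃ Δ 1 →ₗ[ℂ] ℂ)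
variable (hB : ∀ (Δ : Level V) (α₁ β₁ α₂ β₂ : Coh hHD hI hU h₃ Δ 1),
    α₁ ∈ (BettiUniverse.hodge hHD (Var.isSmoothProjective hU h₃ (.pms (pmsCode L ι₁ V Δ))) 1).F 1 →
    β₁ ∈ (BettiUniverse.hodge hHD (Var.isSmoothProjective hU h₃ (.pms (pmsCode L ι₁ V Δ))) 1).F 1 →
    α₂ ∈ Literature.AlgebraicGeometry.Motives.HodgeStructure.complexConj
      ((BettiUniverse.hodge hHD (Var.isSmoothProjective hU h₃ (.pms (pmsCode L ι₁ V Δ))) 1).F 1) →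
    β₂ ∈ Literature.AlgebraicGeometry.Motives.HodgeStructure.complexConj
      ((BettiUniverse.hodge hHD (Var.isSmoothProjective hU h₃ (.pms (pmsCode L ι₁ V Δ))) 1).F 1) →
    B Δ (α₁ + α₂) (β₁ + β₂) =
      Complex.I * (BettiUniverse.trC (Var.isSmoothProjective hU h₃ (.pms (pmsCode L ι₁ V Δ))) 4
          (LinearMap.BilinMap.baseChange ℂ (BettiUniverse.cup (Var.scheme hU h₃ (.pms (pmsCode L ι₁ V Δ))) 2 2)
            (LinearMap.BilinMap.baseChange ℂ (BettiUniverse.cup (Var.scheme hU h₃ (.pms (pmsCode L ι₁ V Δ))) 1 1) β₁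
              (Literature.AlgebraicGeometry.Motives.HodgeStructure.conj α₁))
            ((1 : ℂ) ⊗ₜ[ℚ] hΩ.omega (Var.scheme hU h₃ (.pms (pmsCode L ι₁ V Δ))))) /
        BettiUniverse.trC (Var.isSmoothProjective hU h₃ (.pms (pmsCode L ι₁ V Δ))) 4
          (LinearMap.BilinMap.baseChange ℂ (BettiUniverse.cup (Var.scheme hU h₃ (.pms (pmsCode L ι₁ V Δ))) 2 2)
            ((1 : ℂ) ⊗ₜ[ℚ] hΩ.omega (Var.scheme hU h₃ (.pms (pmsCode L ι₁ V Δ))))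
            ((1 : ℂ) ⊗ₜ[ℚ] hΩ.omega (Var.scheme hU h₃ (.pms (pmsCode L ι₁ V Δ)))))) -
      Complex.I * (BettiUniverse.trC (Var.isSmoothProjective hU h₃ (.pms (pmsCode L ι₁ V Δ))) 4
          (LinearMap.BilinMap.baseChange ℂ (BettiUniverse.cup (Var.scheme hU h₃ (.pms (pmsCode L ι₁ V Δ))) 2 2)
            (LinearMap.BilinMap.baseChange ℂ (BettiUniverse.cup (Var.scheme hU h₃ (.pms (pmsCode L ι₁ V Δ))) 1 1) β₂
              (Literature.AlgebraicGeometry.Motives.HodgeStructure.conj α₂))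
            ((1 : ℂ) ⊗ₜ[ℚ] hΩ.omega (Var.scheme hU h₃ (.pms (pmsCode L ι₁ V Δ))))) /
        BettiUniverse.trC (Var.isSmoothProjective hU h₃ (.pms (pmsCode L ι₁ V Δ))) 4
          (LinearMap.BilinMap.baseChange ℂ (BettiUniverse.cup (Var.scheme hU h₃ (.pms (pmsCode L ι₁ V Δ))) 2 2)
            ((1 : ℂ) ⊗ₜ[ℚ] hΩ.omega (Var.scheme hU h₃ (.pms (pmsCode L ι₁ V Δ))))
            ((1 : ℂ) ⊗ₜ[ℚ] hΩ.omega (Var.scheme hU h₃ (.pms (pmsCode L ι₁ V Δ)))))))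
include hB

/-- **The summand depends only on the double coset**: for `c, c' ∈ towerLevel Γ` and `U(V)(L₀) x K = U(V)(L₀) x' K`,
`B_{Γ_x}(c x, c' x) = B_{Γ_{x'}}(c x', c' x')` ((S1) `hrForm_apply_eq_of_rel` through the dictionary of §2). [cite: VoisinHodgeI2002, §7.3.2] -/
theorem hrForm_apply_eq_of_mk_eq (h : IsAnisotropic L V.Hm) {Γ : Level V} (hΓ : Γ.BelowConjThree)
    (c c' : towerLevel hHD hI hU h₃ hA Γ hΓ) {x x' : V.adelicFin}
    (e : DoubleCoset.mk (ρ V).range Γ.K x = DoubleCoset.mk (ρ V).range Γ.K x') :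
    B (Γ.conj x hΓ) ((c : Π h, W hHD hI hU h₃ Γ hΓ h) x) ((c' : Π h, W hHD hI hU h₃ Γ hΓ h) x) =
      B (Γ.conj x' hΓ) ((c : Π h, W hHD hI hU h₃ Γ hΓ h) x') ((c' : Π h, W hHD hI hU h₃ Γ hΓ h) x') := by
  obtain ⟨γ, r⟩ := exists_rel_of_mk_eq e
  exact hrForm_apply_eq_of_rel hHD hI hU h₃ hA hΩ B hB h hΓ c c' r

/-- **Class-function shape** (the `hF` binder of `ClassSetMass.sum_quotient_map_conj_eq` ∕ (W1)): for `u ∈ U(V)(L₀)` and `k ∈ K`,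
`B_{Γ_{uyk}}(c (uyk), c' (uyk)) = B_{Γ_y}(c y, c' y)`. [cite: VoisinHodgeI2002, §7.3.2] -/
theorem hrForm_summand_mul (h : IsAnisotropic L V.Hm) {Γ : Level V} (hΓ : Γ.BelowConjThree)
    (c c' : towerLevel hHD hI hU h₃ hA Γ hΓ) (y : V.adelicFin) {u k : V.adelicFin} (hu : u ∈ (ρ V).range) (hk : k ∈ Γ.K) :
    B (Γ.conj (u * y * k) hΓ) ((c : Π h, W hHD hI hU h₃ Γ hΓ h) (u * y * k)) ((c' : Π h, W hHD hI hU h₃ Γ hΓ h) (u * y * k)) =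
      B (Γ.conj y hΓ) ((c : Π h, W hHD hI hU h₃ Γ hΓ h) y) ((c' : Π h, W hHD hI hU h₃ Γ hΓ h) y) :=
  (hrForm_apply_eq_of_mk_eq hHD hI hU h₃ hA hΩ B hB h hΓ c c' ((DoubleCoset.eq _ _ _ _).mpr ⟨u, hu, k, hk, rfl⟩)).symm

/-- **On a fibre of `U\G/K' → U\G/K` the level-`Γ` summand is constant**: if the class `q'` (any second subgroup `K'`) lies over the
class `q` of `K = Γ.K`, i.e. `U q'.out K = U q.out K`, then `B_{Γ_{q'.out}}(c q'.out, c' q'.out) = B_{Γ_{q.out}}(c q.out, c' q.out)` — the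
summand identity of `hres` (with (S2) and `ClassSetMass.sum_quotient_eq_sum_fibre` ∕ (W2)). [cite: VoisinHodgeI2002, §7.3.2] -/
theorem hrForm_apply_out_eq_of_fibre (h : IsAnisotropic L V.Hm) {Γ : Level V} (hΓ : Γ.BelowConjThree)
    (c c' : towerLevel hHD hI hU h₃ hA Γ hΓ) {K' : Subgroup V.adelicFin}
    (q' : DoubleCoset.Quotient (((ρ V).range : Subgroup V.adelicFin) : Set V.adelicFin) (K' : Set V.adelicFin))
    (q : DoubleCoset.Quotient (((ρ V).range : Subgroup V.adelicFin) : Set V.adelicFin) (Γ.K : Set V.adelicFin))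
    (e : DoubleCoset.mk (ρ V).range Γ.K q'.out = DoubleCoset.mk (ρ V).range Γ.K q.out) :
    B (Γ.conj q'.out hΓ) ((c : Π h, W hHD hI hU h₃ Γ hΓ h) q'.out) ((c' : Π h, W hHD hI hU h₃ Γ hΓ h) q'.out) =
      B (Γ.conj q.out hΓ) ((c : Π h, W hHD hI hU h₃ Γ hΓ h) q.out) ((c' : Π h, W hHD hI hU h₃ Γ hΓ h) q.out) :=
  hrForm_apply_eq_of_mk_eq hHD hI hU h₃ hA hΩ B hB h hΓ c c' e

/-- The diagonal values are real: `Im B_Δ(α, α) = 0` (Hermitian symmetry (S4a)). [cite: VoisinHodgeI2002, §6.3.2 Thm. 6.32] -/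
theorem hrForm_apply_self_im (Δ : Level V) (α : Coh hHD hI hU h₃ Δ 1) : (B Δ α α).im = 0 := by
  have e := hrForm_symm hHD hI hU h₃ hΩ B hB Δ α α
  have him := congrArg Complex.im e
  rw [Complex.conj_im] at him
  linarith

/-- The diagonal values are non-negative: `0 ≤ Re B_Δ(α, α)` ((S4b) for `α ≠ 0`, and `B_Δ(0,0) = 0`). [cite: VoisinHodgeI2002, §6.3.2 Thm. 6.32] -/
theorem hrForm_apply_self_re_nonneg (h : IsAnisotropic L V.Hm) (Δ : Level V) (α : Coh hHD hI hU h₃ Δ 1) :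
    0 ≤ (B Δ α α).re := by
  by_cases hα : α = 0
  · subst hα
    simp only [map_zero, Complex.zero_re, le_refl]
  · exact (hrForm_posDef hHD hI hU h₃ hΩ B hB h Δ α hα).le

end Summand

end Model.TowerLevel

end HodgeCM

end
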